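import Summits.ABC.IUTFork.Cor312Ind3IteratesVacuityInstances
import HarnessLib

/-!
# [IUTchIII] Thm 3.11 (ii) (Ind3), honest model: the two DYADIC instances under [IUTchI] Def. 3.1 (a) "`√−1 ∈ F`"
# (abc-iut cell, wave-5 seat abc-iut-w5-d172, gen 6; record-only, D-0012; proof-only, 0 definitions)

S. Mochizuki, *Inter-universal Teichmüller theory III*, kurims manuscript (May 2020), Prop. 3.5 (ii) (a)(b)
pp. 104–105, Rmk. 1.1.1 (i) p. 28; *Inter-universal Teichmüller theory I*, Def. 3.1 (a) p. 61 "`F` is a number field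
such that `√−1 ∈ F`" (abc-iut-L5-t2 `InitialThetaData.sqrt_neg_one_mem`) [claim: Mochizuki2012, status: disputed].

Sequel of `Cor312Ind3IteratesVacuityInstances`. abc-iut-w5-d017's census remark (STATUS 09:19:14Z): "in [IUTchI]
Def. 3.1, `√−1 ∈ F` ⇒ every `v ∣ 2` has even `e(v|2)` ⇒ at `v ∣ 2` the (Ind3) depth-`≥ 2` clauses are inhabited iff
`f(v|2) ≥ 2` or [`f = 1`, `4 ∣ e`, open]". THIS FILE realises BOTH dyadic answers by number fields SATISFYING Def. 3.1 (a):
* `Real.two_le_ramificationIdx_of_sq_eq_neg_one` — `√−1 ∈ F_v`, `2 ∈ 𝔭_v` ⇒ `2 ≤ e(v|2)` (`(1 + i)² = 2i`, so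
  `‖1 + i‖ = 2^{−1/2}`, discreteness); the general `Real.le_absRamificationIdx_of_norm_pow_eq_inv` behind it;
* `Real.exists_numberField_sqrt_neg_one_dyadic_nonarchIterImage_eq_empty` — `F = ℚ(√−1) = ℚ[X]/(X² + 1)`, `v ∣ 2`:
  `(e, f) = (2, 1)` and every honest depth-`≥ 2` image is EMPTY (this seat's gen-2 criterion
  `Real.nonarchIterImage_add_two_eq_empty_of_dyadic`, there witnessed by `ℚ(√2)`, here at the IUT-forced field);
* `Real.exists_numberField_sqrt_neg_one_dyadic_nonarchIterImage_two_nonempty` — `F = ℚ(ζ₁₂) = ℚ[X]/(g)`,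
  `g ∣ X⁴ − X² + 1` (`√−1 = θ³`, `ζ₃ = θ⁴`), `v ∣ 2`: `(e, f) = (2, 2)` and the honest depth-`2` image is NONEMPTY
  (abc-iut-w5-d017's `Real.nonarchIterImage_analyticLogv_two_nonempty_of_two_dvd`).
So Def. 3.1 (a) alone does not decide the dyadic (Ind3) clauses of the honest model: both answers occur.

HONEST FRAMING: classical algebraic number theory about the cell's MODEL of the (Ind3) iterates; nothing here asserts
or denies [IUTchIII] Cor. 3.12 or takes a side; census ≠ verdict; typed ≠ proved. No definition, no Prop-valued fact
(D-0067 (1)). [cite: NeukirchANT1999, Ch. II (5.5), Prop. (6.8)] [cite: Lang2002, Ch. V §2 Prop. 2.3]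
-/

noncomputable section

open Set Polynomial

namespace Summit.ABC.IUTFork.Thm311.Real

open NumberField IsDedekindDomain Literature.IUT.LogVolume Literature.IUT.LogThetaLattice
  Literature.NumberTheory.NumberFields

variable {F : Type} [Field F] [NumberField F]

/-! ## §0. `√−1` forces even ramification over `2` -/

/-- In a field of the MLF class over `ℚ_p`: **`‖x‖ⁿ = p⁻¹` forces `n ≤ e`** (`‖x‖ < 1`, so `‖x‖ ≤ p^{−1/e}` by
discreteness, so `p⁻¹ ≤ p^{−n/e}`). [cite: NeukirchANT1999, Ch. II (5.5)] -/
theorem le_absRamificationIdx_of_norm_pow_eq_inv (p : ℕ) [Fact p.Prime] {K : Type*} [NontriviallyNormedField K]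
    [NormedAlgebra ℚ_[p] K] [IsUltrametricDist K] [ProperSpace K] {n : ℕ} (x : K) (hx : ‖x‖ ^ n = (p : ℝ)⁻¹) :
    n ≤ absRamificationIdx p K := by
  have hp1 : (1 : ℝ) < p := by exact_mod_cast (Fact.out : p.Prime).one_lt
  have hp0 : (0 : ℝ) < p := by positivity
  have hxlt : ‖x‖ < 1 := by
    refine lt_of_not_ge fun h => ?_
    have h1 : (1 : ℝ) ≤ ‖x‖ ^ n := one_le_pow₀ h
    rw [hx] at h1
    have h2 : (p : ℝ)⁻¹ < 1 := inv_lt_one_of_one_lt₀ hp1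
    linarith
  have hdisc := norm_le_rpow_of_norm_lt_one p K hxlt
  set e := absRamificationIdx p K with hedef
  have he0 : (0 : ℝ) < e := by exact_mod_cast absRamificationIdx_pos p K
  have h4 : ‖x‖ ^ n ≤ ((p : ℝ) ^ (-(1 / (e : ℝ)))) ^ n := pow_le_pow_left₀ (norm_nonneg _) hdisc n
  rw [hx, ← Real.rpow_natCast, ← Real.rpow_mul hp0.le, ← Real.rpow_neg_one,
    Real.rpow_le_rpow_left_iff hp1, neg_mul, neg_le_neg_iff, one_div, inv_mul_eq_div, div_le_one he0] at h4
  exact_mod_cast h4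

/-- In a field of the MLF class over `ℚ₂`: **`x² = −1` forces `2 ≤ e`** — `(1 + x)² = 2x` has norm `2⁻¹`.
[cite: NeukirchANT1999, Ch. II (5.5)] -/
theorem two_le_absRamificationIdx_of_sq_eq_neg_one {K : Type*} [NontriviallyNormedField K] [NormedAlgebra ℚ_[2] K]
    [IsUltrametricDist K] [ProperSpace K] (x : K) (hx : x ^ 2 = -1) : 2 ≤ absRamificationIdx 2 K := by
  have hxn : ‖x‖ = 1 := by
    have h := congrArg (‖·‖) hx
    simp only [norm_pow, norm_neg, norm_one] at h
    exact (pow_eq_one_iff_of_nonneg (norm_nonneg x) (by norm_num : (2 : ℕ) ≠ 0)).mp h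
  refine le_absRamificationIdx_of_norm_pow_eq_inv 2 (1 + x) ?_
  have hsq : (1 + x) ^ 2 = 2 * x := by linear_combination hx
  rw [← norm_pow, hsq, norm_mul, hxn, mul_one]
  have h := WildDyadic.norm_two (K := K)
  simpa using h

/-- **`√−1 ∈ F_v` with `2 ∈ 𝔭_v` ⇒ `2 ≤ e(v|2)`** (abc-iut-S7's `e(F_v) = e(v|2)`; [IUTchI] Def. 3.1 (a) forces this
at every `v ∣ 2` of the `F` of initial Θ-data). [cite: NeukirchANT1999, Ch. II Prop. (6.8)] -/
theorem two_le_ramificationIdx_of_sq_eq_neg_one (v : HeightOneSpectrum (𝓞 F))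
    (h2 : ((2 : ℕ) : 𝓞 F) ∈ v.asIdeal) (x : v.adicCompletion F) (hx : x ^ 2 = -1) :
    2 ≤ v.asIdeal.ramificationIdx ℤ := by
  haveI : Fact (Nat.Prime 2) := ⟨Nat.prime_two⟩
  have h := two_le_absRamificationIdx_of_sq_eq_neg_one (RescaledCompletion.of F 2 v h2 x)
    (by rw [← map_pow, hx, map_neg, map_one])
  rwa [absRamificationIdx_rescaledCompletion] at h

/-! ## §1. `F = ℚ(√−1)`: the dyadic place has `(e, f) = (2, 1)` and EMPTY depth `≥ 2` -/

/-- **`ℚ(√−1)` (Def. 3.1 (a)'s minimal field): at its place over `2`, `(e, f) = (2, 1)` and every honest depth-`≥ 2`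
(Ind3) iterate image for the analytic logarithms is EMPTY** (this seat's gen-2 criterion for `(p, e, f) = (2, 2, 1)`;
the tame hypothesis of p414009 fails). [claim: Mochizuki2012, status: disputed] -/
theorem exists_numberField_sqrt_neg_one_dyadic_nonarchIterImage_eq_empty :
    ∃ (F : Type) (_ : Field F) (_ : NumberField F) (v : HeightOneSpectrum (𝓞 F)),
      (∃ i : F, i ^ 2 = -1) ∧ residueChar F v = 2 ∧ v.asIdeal.ramificationIdx ℤ = 2 ∧ v.asIdeal.inertiaDeg ℤ = 1 ∧
        ¬ v.asIdeal.ramificationIdx ℤ ≤ residueChar F v - 1 ∧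
          ∀ k : ℕ, nonarchIterImage (analyticLogv F) v (k + 2) = ∅ := by
  obtain ⟨F, _, _, θ, hθ, hdeg⟩ := exists_numberField_aeval_eq_zero_finrank_le (X ^ 2 + C 1 : ℚ[X])
    (by rw [natDegree_X_pow_add_C]; norm_num)
  have hi : θ ^ 2 = -1 := by
    have h1 : aeval θ (X ^ 2 + C 1 : ℚ[X]) = θ ^ 2 + 1 := by simp
    rw [h1] at hθ
    linear_combination hθ
  rw [natDegree_X_pow_add_C] at hdeg
  obtain ⟨v, hv⟩ := exists_heightOneSpectrum_natCast_mem' (F := F) Nat.prime_two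
  have hx : (algebraMap F (v.adicCompletion F) θ) ^ 2 = -1 := by rw [← map_pow, hi, map_neg, map_one]
  have he2 : 2 ≤ v.asIdeal.ramificationIdx ℤ := two_le_ramificationIdx_of_sq_eq_neg_one v hv _ hx
  have hef : v.asIdeal.ramificationIdx ℤ * v.asIdeal.inertiaDeg ℤ ≤ 2 :=
    (ramificationIdx_mul_inertiaDeg_le_finrank' v).trans hdeg
  haveI := v.isPrime
  have hfpos : 0 < v.asIdeal.inertiaDeg ℤ := Ideal.inertiaDeg_pos (R := ℤ) (q := v.asIdeal)
  have he : v.asIdeal.ramificationIdx ℤ = 2 := by nlinarith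
  have hf : v.asIdeal.inertiaDeg ℤ = 1 := by nlinarith
  have hres : residueChar F v = 2 := residueChar_eq_of_prime_natCast_mem v Nat.prime_two hv
  exact ⟨F, inferInstance, inferInstance, v, ⟨θ, hi⟩, hres, he, hf, by rw [hres, he]; omega,
    fun k => nonarchIterImage_add_two_eq_empty_of_dyadic v hv he hf k⟩

/-! ## §2. `F = ℚ(ζ₁₂) ∋ √−1`: the dyadic place has `(e, f) = (2, 2)` and INHABITED depth `2` -/

/-- `X⁴ − X² + 1` (the `12`-th cyclotomic polynomial) has degree `4`. [folklore] -/
theorem natDegree_X_pow_four_sub_X_sq_add_one : (X ^ 4 - X ^ 2 + C 1 : ℚ[X]).natDegree = 4 := by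
  compute_degree!

/-- **A number field with `√−1` and `ζ₃`, of degree `≤ 4`**: `ℚ[X]/(g)`, `g ∣ X⁴ − X² + 1` (`= ℚ(ζ₁₂)`); for a root
`θ`, `√−1 = θ³` (`θ⁶ = −1`) and `ζ₃ = θ⁴` (`θ⁸ + θ⁴ + 1 = (θ⁴ − θ² + 1)(θ⁴ + θ² + 1)`). [cite: Lang2002, Ch. V §2 Prop. 2.3] -/
theorem exists_numberField_sqrt_neg_one_and_cubeRoot_finrank_le :
    ∃ (F : Type) (_ : Field F) (_ : NumberField F) (i ω : F),
      i ^ 2 = -1 ∧ ω ^ 2 + ω + 1 = 0 ∧ Module.finrank ℚ F ≤ 4 := by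
  obtain ⟨F, _, _, θ, hθ, hdeg⟩ := exists_numberField_aeval_eq_zero_finrank_le (X ^ 4 - X ^ 2 + C 1 : ℚ[X])
    (by rw [natDegree_X_pow_four_sub_X_sq_add_one]; norm_num)
  have h0 : θ ^ 4 - θ ^ 2 + 1 = 0 := by
    have h1 : aeval θ (X ^ 4 - X ^ 2 + C 1 : ℚ[X]) = θ ^ 4 - θ ^ 2 + 1 := by simp
    rw [h1] at hθ
    exact hθ
  refine ⟨F, inferInstance, inferInstance, θ ^ 3, θ ^ 4, ?_, ?_,
    by rwa [natDegree_X_pow_four_sub_X_sq_add_one] at hdeg⟩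
  · linear_combination (θ ^ 2 + 1) * h0
  · linear_combination (θ ^ 4 + θ ^ 2 + 1) * h0

/-- **`ℚ(ζ₁₂) ∋ √−1` (a field satisfying Def. 3.1 (a)): at its place over `2`, `(e, f) = (2, 2)` — `2 ≤ e` from `√−1`,
`2 ≤ f` from `ζ₃`, `e·f ≤ [F:ℚ] ≤ 4` — and the honest depth-`2` (Ind3) iterate image for the analytic logarithms is
NONEMPTY** (abc-iut-w5-d017's `Real.nonarchIterImage_analyticLogv_two_nonempty_of_two_dvd`). Together with §1: Def. 3.1
(a) alone does not decide the dyadic clauses of the honest model. [claim: Mochizuki2012, status: disputed] -/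
theorem exists_numberField_sqrt_neg_one_dyadic_nonarchIterImage_two_nonempty :
    ∃ (F : Type) (_ : Field F) (_ : NumberField F) (v : HeightOneSpectrum (𝓞 F)),
      (∃ i : F, i ^ 2 = -1) ∧ residueChar F v = 2 ∧ v.asIdeal.ramificationIdx ℤ = 2 ∧ v.asIdeal.inertiaDeg ℤ = 2 ∧
        ¬ v.asIdeal.ramificationIdx ℤ ≤ residueChar F v - 1 ∧
          (nonarchIterImage (analyticLogv F) v 2).Nonempty := by
  obtain ⟨F, _, _, i, ω, hi, hω, hdeg⟩ := exists_numberField_sqrt_neg_one_and_cubeRoot_finrank_le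
  obtain ⟨v, hv⟩ := exists_heightOneSpectrum_natCast_mem' (F := F) Nat.prime_two
  have hx : (algebraMap F (v.adicCompletion F) i) ^ 2 = -1 := by rw [← map_pow, hi, map_neg, map_one]
  have hw : (algebraMap F (v.adicCompletion F) ω) ^ 2 + algebraMap F (v.adicCompletion F) ω + 1 = 0 := by
    rw [← map_pow, ← map_add, ← map_one (algebraMap F (v.adicCompletion F)), ← map_add, hω, map_zero]
  have he2 : 2 ≤ v.asIdeal.ramificationIdx ℤ := two_le_ramificationIdx_of_sq_eq_neg_one v hv _ hx
  have hf2 : 2 ≤ v.asIdeal.inertiaDeg ℤ := two_le_inertiaDeg_of_sq_add_self_add_one_eq_zero v hv _ hw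
  have hef : v.asIdeal.ramificationIdx ℤ * v.asIdeal.inertiaDeg ℤ ≤ 4 :=
    (ramificationIdx_mul_inertiaDeg_le_finrank' v).trans hdeg
  have he : v.asIdeal.ramificationIdx ℤ = 2 := by nlinarith
  have hf : v.asIdeal.inertiaDeg ℤ = 2 := by nlinarith
  have hres : residueChar F v = 2 := residueChar_eq_of_prime_natCast_mem v Nat.prime_two hv
  exact ⟨F, inferInstance, inferInstance, v, ⟨i, hi⟩, hres, he, hf, by rw [hres, he]; omega,
    nonarchIterImage_analyticLogv_two_nonempty_of_two_dvd v hres (by rw [he]) (by rw [hf])⟩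

end Summit.ABC.IUTFork.Thm311.Real

end
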